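import Mathlib
import Summits.NavierStokesRegularity.FluidComputer.WobblingBeltramiHost
import HarnessLib

/-!
# Inherited rigid translates: the Beltrami pattern drifting through a uniformly rotating fluid
# (closure of the (G)-caveat of the X1″ memo; refuter K-CHECK 2026-08-25 12:08Z (3))

HONEST FRAMING (cell `ns-blowup`, seat `ns-blowup-instab`, human ruling D-0035): nothing here is a
claim about Navier–Stokes blow-up. WHAT THIS IS NOT: not a statement about the marginal tower N1*;
it is the kernel form of the refuter's closure of the one caveat left open in
`instab/X1pp-SKENE-TOBIAS.md` §4: the only UNFORCED («inherited») way for a Beltrami pattern to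
slip rigidly through the fluid is a uniform background rotation `Ω_b` (the leading effect of level
`k−1`'s vorticity on level `k`), and that slip opens no DC channel.

* §1 (`fderiv_apply_const_eq_cross_add_gradient`): for a Beltrami field `b` with constant
  coefficient `λ̄` and a constant vector `c`, `Db(x)[c] = λ̄ · b(x) × c + ∇⟪c, b⟫(x)` — the polarised
  Lamb identity (`BeltramiHostLinearisation.convect_add_convect_eq_cross_add_gradient`) with one
  constant factor.
* §2 **Drifting Beltrami pattern** (`isClassicalNSSolutionOn_beltramiDrift`): for `b` smooth,
  divergence free, strong Beltrami-`λ̄`, and ANY constant drift velocity `c`, the rigid translate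
  `u(t, x) = b(x + t c)` with pressure `p = −½|u|² − ⟪c, u⟫` solves the Navier–Stokes system with force
  `f = νλ̄²u + λ̄ · u × c`. For `c = (2/λ̄)Ω_b` the second term is `2 u × Ω_b = −2Ω_b × u`, the CORIOLIS
  force of a frame rotating at `Ω_b`: the pattern drifting at `(2/λ̄)Ω_b` is an exact solution of the
  rotating (viscously maintained) system — the refuter's «b(x + (2/λ)Ω_b t) is an exact rotating-Euler
  solution» (`isClassicalNSSolutionOn_beltramiDrift_coriolis`).
* §3 **No DC channel** (`absoluteVorticity_comoving_beltrami`): in the frame co-moving with the drift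
  the velocity is `V′ = b + (2/λ̄)Ω_b` (LEMMA W2 / galileanBoost) and the ABSOLUTE vorticity is
  `curl V′ + 2Ω_b = λ̄ V′` exactly — the co-moving flow is Beltrami with respect to absolute vorticity,
  so absolute vortex lines are streamlines of `V′` and the steady tangency lemma (R12′ S3 /
  `StagnationPointIdentities`, refuter K21) applies verbatim: the adapted host term vanishes at every
  inherited level. Together with `WobblingBeltramiHost` (forced AC slip = base level only) this closes
  host class (II) of the memo at all levels.

All statements are pointwise identities over the tree's `curl`, `cross`, `convect`, `gradient`,
`IsBeltrami`, `IsClassicalNSSolutionOn`. References: Majda–Bertozzi 2002 §1.1 (Lamb form), §2.3.2;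
cell files `KILLSHEET.md` §XIX, `instab/X1pp-SKENE-TOBIAS.md` §4, `instab/CLAIMS-A10-A13.md` A13(c).
-/

noncomputable section

open Set Real InnerProductSpace
open scoped RealInnerProductSpace ContDiff Laplacian Topology

namespace Summit.NavierStokesRegularity.FluidComputer.RotatingBeltramiDrift

open Literature.Analysis.FluidPDE Literature.Analysis.FluidPDE.ABC BeltramiHostLinearisation
  BeltramiSextuplet WobblingBeltramiHost

/-! ### §0 Component identities for the tree's `cross` -/

/-- `0 × a = 0`. -/
theorem cross_zero_left (a : EuclideanSpace ℝ (Fin 3)) : cross 0 a = 0 := by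
  ext i
  fin_cases i <;> simp [cross]

/-- `(c a) × b = c (a × b)`. -/
theorem cross_smul_left (c : ℝ) (a b : EuclideanSpace ℝ (Fin 3)) :
    cross (c • a) b = c • cross a b := by
  ext i
  fin_cases i <;> simp [cross, cross_apply]

/-- `a × (c b) = c (a × b)`. -/
theorem cross_smul_right (c : ℝ) (a b : EuclideanSpace ℝ (Fin 3)) :
    cross a (c • b) = c • cross a b := by
  ext i
  fin_cases i <;> simp [cross, cross_apply]

/-! ### §1 The directional derivative of a Beltrami field along a constant vector -/

/-- For a Beltrami field with constant coefficient `λ̄` and a constant vector `c`: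
`Db(x)[c] = λ̄ · b(x) × c + ∇⟪c, b⟫(x)` (polarised Lamb identity with `v ≡ c`). -/
theorem fderiv_apply_const_eq_cross_add_gradient
    {b : EuclideanSpace ℝ (Fin 3) → EuclideanSpace ℝ (Fin 3)} {lam0 : ℝ}
    (hb : IsBeltrami b fun _ => lam0) {x : EuclideanSpace ℝ (Fin 3)} (hbx : DifferentiableAt ℝ b x)
    (c : EuclideanSpace ℝ (Fin 3)) :
    fderiv ℝ b x c = lam0 • cross (b x) c + gradient (fun y => ⟪c, b y⟫) x := by
  have h := convect_add_convect_eq_cross_add_gradient (v := fun _ => c) (w := b)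
    (differentiableAt_const c) hbx
  have h1 : convect (fun _ : EuclideanSpace ℝ (Fin 3) => c) b x = fderiv ℝ b x c := by
    rw [convect_apply]
  have h2 : convect b (fun _ : EuclideanSpace ℝ (Fin 3) => c) x = 0 := by
    rw [convect_apply, fderiv_fun_const, Pi.zero_apply, zero_apply]
  have h3 : curl (fun _ : EuclideanSpace ℝ (Fin 3) => c) x = 0 :=
    curl_eq_zero_of_fderiv_eq_zero (by simp)
  rw [h1, h2, add_zero, h3, hb x, cross_zero_left, zero_add, cross_smul_left] at h
  exact h

/-! ### §2 The drifting pattern is an exact solution (Coriolis form) -/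

/-- **Drifting Beltrami pattern.** For `b` smooth, divergence free, strong Beltrami-`λ̄`, and a
constant drift velocity `c`: `u(t, x) = b(x + t c)`, `p = −½|u|² − ⟪c, u⟫` solve the Navier–Stokes
system on `ℝ³ × ℝ` with force `νλ̄²u + λ̄ · u × c` (viscous maintenance + a Coriolis-type force). -/
theorem isClassicalNSSolutionOn_beltramiDrift
    {b : EuclideanSpace ℝ (Fin 3) → EuclideanSpace ℝ (Fin 3)} {lam0 : ℝ} (ν : ℝ)
    (c : EuclideanSpace ℝ (Fin 3)) (hb : IsBeltrami b fun _ => lam0) (hbs : ContDiff ℝ ∞ b)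
    (hbdiv : VectorCalculus.IsDivFree b) :
    IsClassicalNSSolutionOn univ ν
      (fun t x => (ν * lam0 ^ 2) • b (x + t • c) + lam0 • cross (b (x + t • c)) c)
      (fun t x => b (x + t • c))
      (fun t x => -(‖b (x + t • c)‖ ^ 2 / 2) - ⟪c, b (x + t • c)⟫) := by
  have hbd : Differentiable ℝ b := hbs.differentiable (by simp)
  -- joint smoothness
  have hsu : ContDiff ℝ ∞ (fun q : ℝ × EuclideanSpace ℝ (Fin 3) => b (q.2 + q.1 • c)) :=
    hbs.comp (contDiff_snd.add (contDiff_fst.smul contDiff_const))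
  have hsp : ContDiff ℝ ∞ (fun q : ℝ × EuclideanSpace ℝ (Fin 3) =>
      -(‖b (q.2 + q.1 • c)‖ ^ 2 / 2) - ⟪c, b (q.2 + q.1 • c)⟫) :=
    ((hsu.norm_sq ℝ).div_const 2).neg.sub (contDiff_const.inner ℝ hsu)
  refine ⟨hsu.contDiffOn, hsp.contDiffOn, ?_, ?_⟩
  · intro t _ x
    set s : EuclideanSpace ℝ (Fin 3) := t • c with hs
    have hbt : IsBeltrami (fun y => b (y + s)) fun _ => lam0 := hb.translate s
    have hbts : ContDiff ℝ ∞ (fun y => b (y + s)) := contDiff_translate hbs s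
    have hbt2 : ContDiff ℝ 2 (fun y => b (y + s)) := contDiff_infty.1 hbts 2
    have hbtd : Differentiable ℝ (fun y => b (y + s)) := hbts.differentiable (by simp)
    have hbtdiv : VectorCalculus.IsDivFree (fun y => b (y + s)) := isDivFree_translate hbdiv s
    -- time derivative: d/dt b(x + t c) = Db(x + t c)[c]
    have h1 : timeDerivWithin univ (fun r y => b (y + r • c)) t x = fderiv ℝ b (x + s) c := by
      rw [timeDerivWithin_apply, derivWithin_univ]
      have h := hasDerivAt_comp_translate hbd differentiable_id c x t
      simp only [id_eq, deriv_id, one_smul] at h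
      exact h.deriv
    -- Db[c] along the translate, via §1 applied to the translated field
    have h1' : fderiv ℝ b (x + s) c =
        lam0 • cross (b (x + s)) c + gradient (fun y => ⟪c, b (y + s)⟫) x := by
      have := fderiv_apply_const_eq_cross_add_gradient hbt (hbtd x) c
      rw [fderiv_comp_add_right] at this
      exact this
    -- convective term
    have h2 : convect (fun y => b (y + s)) (fun y => b (y + s)) x =
        gradient (fun y => ‖b (y + s)‖ ^ 2 / 2) x := hbt.convect_eq_gradient (hbtd x)
    -- viscous term
    have h3 : Δ (fun y => b (y + s)) x = -(lam0 ^ 2) • b (x + s) :=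
      laplacian_eq_of_strongBeltrami hbt hbt2 hbtdiv x
    -- pressure gradient
    have hd1 : DifferentiableAt ℝ (fun y => -(‖b (y + s)‖ ^ 2 / 2)) x :=
      ((((hbts.norm_sq ℝ).div_const 2).neg).differentiable (by simp)) x
    have hd2 : DifferentiableAt ℝ (fun y => ⟪c, b (y + s)⟫) x :=
      (differentiableAt_const c).inner ℝ (hbtd x)
    have h4 : gradient (fun y => -(‖b (y + s)‖ ^ 2 / 2) - ⟪c, b (y + s)⟫) x =
        -gradient (fun y => ‖b (y + s)‖ ^ 2 / 2) x - gradient (fun y => ⟪c, b (y + s)⟫) x := by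
      have e1 : gradient (fun y => -(‖b (y + s)‖ ^ 2 / 2) - ⟪c, b (y + s)⟫) x =
          gradient (fun y => -(‖b (y + s)‖ ^ 2 / 2)) x - gradient (fun y => ⟪c, b (y + s)⟫) x := by
        simp only [gradient]
        rw [fderiv_fun_sub hd1 hd2, map_sub]
      rw [e1, gradient_fun_neg' _ x]
    show timeDerivWithin univ (fun r y => b (y + r • c)) t x +
        convect (fun y => b (y + s)) (fun y => b (y + s)) x =
      ν • Δ (fun y => b (y + s)) x - gradient (fun y => -(‖b (y + s)‖ ^ 2 / 2) - ⟪c, b (y + s)⟫) x +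
        ((ν * lam0 ^ 2) • b (x + s) + lam0 • cross (b (x + s)) c)
    rw [h1, h1', h2, h3, h4]
    simp only [smul_smul]
    ext i
    simp only [PiLp.add_apply, PiLp.sub_apply, PiLp.smul_apply, PiLp.neg_apply, smul_eq_mul]
    ring
  · intro t _ y
    exact isDivFree_translate hbdiv (t • c) y

/-- **Coriolis form.** With `c = (2/λ̄)Ω_b` (`λ̄ ≠ 0`) the force of
`isClassicalNSSolutionOn_beltramiDrift` is `νλ̄²u + 2 u × Ω_b = νλ̄²u − 2 Ω_b × u`: viscous
maintenance plus exactly the CORIOLIS force of a frame rotating at `Ω_b`. So a Beltrami-`λ̄`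
pattern embedded in a uniform background rotation `Ω_b` (inherited from the coarser tower level)
DRIFTS rigidly at `(2/λ̄)Ω_b` — the one unforced realisation of host class (II). -/
theorem isClassicalNSSolutionOn_beltramiDrift_coriolis
    {b : EuclideanSpace ℝ (Fin 3) → EuclideanSpace ℝ (Fin 3)} {lam0 : ℝ} (hlam : lam0 ≠ 0) (ν : ℝ)
    (Ω : EuclideanSpace ℝ (Fin 3)) (hb : IsBeltrami b fun _ => lam0) (hbs : ContDiff ℝ ∞ b)
    (hbdiv : VectorCalculus.IsDivFree b) :
    IsClassicalNSSolutionOn univ ν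
      (fun t x => (ν * lam0 ^ 2) • b (x + t • ((2 / lam0) • Ω)) +
        (2 : ℝ) • cross (b (x + t • ((2 / lam0) • Ω))) Ω)
      (fun t x => b (x + t • ((2 / lam0) • Ω)))
      (fun t x => -(‖b (x + t • ((2 / lam0) • Ω))‖ ^ 2 / 2) - ⟪(2 / lam0) • Ω, b (x + t • ((2 / lam0) • Ω))⟫) := by
  have h := isClassicalNSSolutionOn_beltramiDrift ν ((2 / lam0) • Ω) hb hbs hbdiv
  have hf : (fun (t : ℝ) (x : EuclideanSpace ℝ (Fin 3)) => (ν * lam0 ^ 2) • b (x + t • ((2 / lam0) • Ω)) +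
      lam0 • cross (b (x + t • ((2 / lam0) • Ω))) ((2 / lam0) • Ω)) =
      (fun (t : ℝ) (x : EuclideanSpace ℝ (Fin 3)) => (ν * lam0 ^ 2) • b (x + t • ((2 / lam0) • Ω)) +
        (2 : ℝ) • cross (b (x + t • ((2 / lam0) • Ω))) Ω) := by
    funext t x
    have h2 : lam0 * (2 / lam0) = 2 := by field_simp
    simp only [cross_smul_right, smul_smul, h2]
  rw [hf] at h
  exact h

/-! ### §3 Absolute vorticity in the co-moving frame: Beltrami, hence no DC channel -/

/-- **Absolute vorticity of the co-moving flow is Beltrami.** For a strong Beltrami-`λ̄` field `b`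
(`λ̄ ≠ 0`) and a background rotation `Ω_b`, the co-moving velocity `V′ = b + (2/λ̄)Ω_b` satisfies
`curl V′ + 2Ω_b = λ̄ V′` pointwise: absolute vortex lines are streamlines of `V′`, so they vanish
at and are tangent to the invariant manifolds of the (drift-displaced) hyperbolic points — the
steady tangency lemma R12′/K21 applies and the inherited drift opens no DC channel. -/
theorem absoluteVorticity_comoving_beltrami
    {b : EuclideanSpace ℝ (Fin 3) → EuclideanSpace ℝ (Fin 3)} {lam0 : ℝ} (hlam : lam0 ≠ 0)
    (hb : IsBeltrami b fun _ => lam0) (Ω x : EuclideanSpace ℝ (Fin 3)) :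
    curl (fun y => b y + (2 / lam0) • Ω) x + (2 : ℝ) • Ω = lam0 • (b x + (2 / lam0) • Ω) := by
  have hc : curl (fun y => b y + (2 / lam0) • Ω) x = curl b x := by
    rw [curl_eq_curlCLM, curl_eq_curlCLM, fderiv_add_const]
  rw [hc, hb x, smul_add, smul_smul, mul_div_cancel₀ _ hlam]

/-- The same with the rotation written as half the background vorticity, `Ω_b = ½ω_b`:
`curl(b + ω_b/λ̄) + ω_b = λ̄ (b + ω_b/λ̄)`. -/
theorem absoluteVorticity_comoving_beltrami'
    {b : EuclideanSpace ℝ (Fin 3) → EuclideanSpace ℝ (Fin 3)} {lam0 : ℝ} (hlam : lam0 ≠ 0)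
    (hb : IsBeltrami b fun _ => lam0) (w x : EuclideanSpace ℝ (Fin 3)) :
    curl (fun y => b y + (1 / lam0) • w) x + w = lam0 • (b x + (1 / lam0) • w) := by
  have hc : curl (fun y => b y + (1 / lam0) • w) x = curl b x := by
    rw [curl_eq_curlCLM, curl_eq_curlCLM, fderiv_add_const]
  rw [hc, hb x, smul_add, smul_smul, mul_one_div_cancel hlam, one_smul]

end Summit.NavierStokesRegularity.FluidComputer.RotatingBeltramiDrift
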